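import Summits.KontsevichZagierPeriods.KontsevichZagierPeriods.Theorems.HurwitzMicroSectorsNormalFormPrincipleM4SharedTools

/-!
# `NormalFormPrinciple` (stmt-KontsevichZagierPeriods-3869), line `SketchIdeator1` —
# leaf `stub_boxRigidity`, layer `Island`: the cubical chart carries `W` onto the triangle

Pure proof file (registered sub-goal `isl_chart_W` of the PRODUCT ISLAND at height `q`,
`q : ℕ`, `2 ≤ q`, lead seat c9; `--supports` the crux). Step (ii) of the chain `2q·V ∼ 2D + P`:
the change of variables `(x₀, x₁) ↦ (t₀, t₁) = (x₀, x₀x₁)` of the open unit square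
`□² = {x | ∀ i, x i ∈ (0,1)}` onto the decreasing open triangle `Δ₂ = {0 < t₁ < t₀ < 1}`
(Jacobian `x₀`) carries

  `W = [□², x₀/((q − x₀)(q − x₀x₁))]`   to   `Tr = [Δ₂, 1/((q − t₀)(q − t₁))]`,

so `[W] − [Tr]` is ONE change-of-variables move of the Kontsevich–Zagier calculus (rule (2)). It is
a single application of the generic dimension-two cubical chart `M3.m4_box_sub_simplex2` with
`g(t) = 1/((q − t₀)(q − t₁))`; the pull-back identity `x₀/((q−x₀)(q−x₀x₁)) = g(x₀, x₀x₁)·x₀` is a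
purely algebraic rewrite (no nonvanishing is needed, so the height hypothesis `2 ≤ q` is not used).

References: M. Kontsevich, D. Zagier, *Periods* (2001), §1.1–1.2, rule (2). No definitions are
introduced.
-/

noncomputable section

open MeasureTheory Set
open Literature.NumberTheory.Transcendental Literature.NumberTheory.Transcendental.KZ

namespace Summit.KontsevichZagierPeriods.HurwitzMicroSectors.NormalFormPrinciple.PiBox.Island

/-- **Registered entry (`isl_chart_W`).** The cubical chart `(x₀, x₁) ↦ (x₀, x₀x₁)` of the open unit
square onto the triangle `Δ₂ = {0 < t₁ < t₀ < 1}` (Jacobian `x₀`) carries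
`W = [□², x₀/((q − x₀)(q − x₀x₁))]` to `Tr = [Δ₂, 1/((q − t₀)(q − t₁))]`: `[W] − [Tr]` is one
change-of-variables move. [cite: KontsevichZagier2001, §1.2 rule (2)] -/
theorem isl_chart_W :
    ∀ (q : ℕ), 2 ≤ q → ∀ (W Tr : IntegralRep 2),
      W.domain = {x | ∀ i, x i ∈ Set.Ioo (0:ℝ) 1} →
      EqOn W.integrand (fun x => x 0 / (((q:ℝ) - x 0) * ((q:ℝ) - x 0 * x 1))) W.domain →
      Tr.domain = {t | 0 < t 1 ∧ t 1 < t 0 ∧ t 0 < 1} →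
      EqOn Tr.integrand (fun t => 1 / (((q:ℝ) - t 0) * ((q:ℝ) - t 1))) Tr.domain →
      of W - of Tr ∈ relations := by
  intro q _hq W Tr hWd hWi hTd hTi
  refine M3.m4_box_sub_simplex2 (fun t => 1 / (((q:ℝ) - t 0) * ((q:ℝ) - t 1))) W Tr hWd hTd hTi
    fun x hx => ?_
  rw [hWi hx]
  simp only [Matrix.cons_val_zero, Matrix.cons_val_one]
  rw [one_div_mul_eq_div]

end Summit.KontsevichZagierPeriods.HurwitzMicroSectors.NormalFormPrinciple.PiBox.Island
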